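import Literature.AlgebraicGeometry.Smoothening.ConormalSplitting
import HarnessLib

/-!
# The conormal criterion at a point, in terms of `L ⊗_S Ω[S⁄R] → L ⊗ Ω[(S/J)⁄R]`

Topic: `Literature/AlgebraicGeometry/Smoothening`; a reformulation lemma for
`ConormalSplitting.lean`. There the hypothesis of the openness criterion
(`eq_bot_of_formallySmooth_of_injective`, GW II Thm. 18.74 (iii)) is the injectivity of the
base change `L ⊗_{S/J} ((S/J) ⊗_S Ω[S⁄R]) → L ⊗_{S/J} Ω[(S/J)⁄R]` of the map `toKaehler` of
Mathlib's extension `0 → J → S → S/J → 0`. This file identifies that map with the naive one,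
`L ⊗_S Ω[S⁄R] → L ⊗_S Ω[(S/J)⁄R]` (base change along `S → L` of
`KaehlerDifferential.map R R S (S/J)`), which is what one computes in examples and in the proof
of BLR Lemma 3.3/1:

* `tensorQuotientEquiv J L M : L ⊗[S] M ≃ L ⊗[S ⧸ J] M` for an `S/J`-module `M` and an
  `S/J`-algebra `L` (tensoring over `S` or over its quotient `S/J` is the same) [folklore];
* `toKaehler_baseChange_comp` — the comparison square;
* `injective_toKaehler_baseChange_iff` — **the two injectivity conditions are equivalent**;
* `eq_bot_of_formallySmooth_of_injective_map` — `ConormalSplitting`'s criterion restated with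
  the naive map (GW II Thm. 18.74 with Prop. 18.76, affine-locally).

No named facts are introduced (D-0026).

## References

* U. Görtz, T. Wedhorn, *Algebraic Geometry II*, Springer Spektrum 2023, Thm. 18.74,
  Prop. 18.76 (PDF pp. 106–107). [GortzWedhorn2023]
-/

noncomputable section

open scoped TensorProduct
open Algebra KaehlerDifferential IsLocalRing

namespace Literature.AlgebraicGeometry.Smoothening

universe u

section TensorQuotient

variable {S : Type u} [CommRing S] (J : Ideal S) (L : Type u) [CommRing L] [Algebra S L]
  [Algebra (S ⧸ J) L] [IsScalarTower S (S ⧸ J) L]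
  (M : Type u) [AddCommGroup M] [Module S M] [Module (S ⧸ J) M] [IsScalarTower S (S ⧸ J) M]

/-- The `S/J`-action can be moved across `⊗[S]` for `S/J`-modules (it comes from the
`S`-action). [folklore] -/
theorem compatibleSMul_quotient : TensorProduct.CompatibleSMul S (S ⧸ J) L M where
  smul_tmul t l m := by
    obtain ⟨s, rfl⟩ := Ideal.Quotient.mk_surjective t
    change ((algebraMap S (S ⧸ J) s) • l) ⊗ₜ[S] m = l ⊗ₜ[S] ((algebraMap S (S ⧸ J) s) • m)
    rw [IsScalarTower.algebraMap_smul, IsScalarTower.algebraMap_smul, TensorProduct.smul_tmul]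

/-- **`L ⊗_S M = L ⊗_{S/J} M`** for an `S/J`-module `M` and an `S/J`-algebra `L` (Mathlib
`TensorProduct.equivOfCompatibleSMul`). [folklore] -/
def tensorQuotientEquiv : L ⊗[S] M ≃ₗ[L] L ⊗[S ⧸ J] M :=
  haveI := compatibleSMul_quotient J L M
  (TensorProduct.equivOfCompatibleSMul S (S ⧸ J) L L M).symm

/-- `tensorQuotientEquiv` on pure tensors. [folklore] -/
@[simp]
theorem tensorQuotientEquiv_tmul (l : L) (m : M) :
    tensorQuotientEquiv J L M (l ⊗ₜ[S] m) = l ⊗ₜ[S ⧸ J] m := by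
  haveI := compatibleSMul_quotient J L M
  rfl

/-- The inverse of `tensorQuotientEquiv` on pure tensors. [folklore] -/
@[simp]
theorem tensorQuotientEquiv_symm_tmul (l : L) (m : M) :
    (tensorQuotientEquiv J L M).symm (l ⊗ₜ[S ⧸ J] m) = l ⊗ₜ[S] m := by
  haveI := compatibleSMul_quotient J L M
  rfl

end TensorQuotient

section Bridge

variable (R : Type u) [CommRing R] (S : Type u) [CommRing S] [Algebra R S] (J : Ideal S)
  (L : Type u) [CommRing L] [Algebra S L] [Algebra (S ⧸ J) L] [IsScalarTower S (S ⧸ J) L]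

/-- **The comparison square**: under `L ⊗_{S/J} ((S/J) ⊗_S Ω[S⁄R]) ≅ L ⊗_S Ω[S⁄R]` and
`L ⊗_{S/J} Ω[(S/J)⁄R] ≅ L ⊗_S Ω[(S/J)⁄R]`, the base change of `toKaehler` is the base change of
`Ω[S⁄R] → Ω[(S/J)⁄R]`. [folklore] -/
theorem toKaehler_baseChange_comp :
    (tensorQuotientEquiv J L Ω[(S ⧸ J)⁄R]).toLinearMap ∘ₗ
        (KaehlerDifferential.map R R S (S ⧸ J)).baseChange L =
      ((quotientExtension R S J).toKaehler.baseChange L) ∘ₗ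
        (TensorProduct.AlgebraTensorModule.cancelBaseChange S (S ⧸ J) L L Ω[S⁄R]).symm.toLinearMap := by
  refine TensorProduct.AlgebraTensorModule.ext fun l ω => ?_
  simp only [LinearMap.comp_apply, LinearEquiv.coe_coe, LinearMap.baseChange_tmul,
    tensorQuotientEquiv_tmul]
  change _ = l ⊗ₜ[S ⧸ J] (KaehlerDifferential.mapBaseChange R S (S ⧸ J)) (1 ⊗ₜ ω)
  rw [KaehlerDifferential.mapBaseChange_tmul, one_smul]

/-- **The two injectivity conditions agree.** [folklore] -/
theorem injective_toKaehler_baseChange_iff :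
    Function.Injective ((quotientExtension R S J).toKaehler.baseChange L) ↔
      Function.Injective ((KaehlerDifferential.map R R S (S ⧸ J)).baseChange L) := by
  set tQ := tensorQuotientEquiv J L Ω[(S ⧸ J)⁄R]
  set canc := TensorProduct.AlgebraTensorModule.cancelBaseChange S (S ⧸ J) L L Ω[S⁄R]
  set φ := (KaehlerDifferential.map R R S (S ⧸ J)).baseChange L
  set ψ := (quotientExtension R S J).toKaehler.baseChange L
  have h : ∀ x, tQ (φ x) = ψ (canc.symm x) := fun x =>
    LinearMap.congr_fun (toKaehler_baseChange_comp R S J L) x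
  constructor
  · intro hψ x₁ x₂ hx
    have e : ψ (canc.symm x₁) = ψ (canc.symm x₂) := by rw [← h, ← h, hx]
    exact canc.symm.injective (hψ e)
  · intro hφ y₁ y₂ hy
    have e : tQ (φ (canc y₁)) = tQ (φ (canc y₂)) := by
      rw [h, h, LinearEquiv.symm_apply_apply, LinearEquiv.symm_apply_apply, hy]
    exact canc.injective (hφ (tQ.injective e))

/-- **Openness criterion, naive form** (GW II Thm. 18.74 (iii)⇒(i), étale case, with
Prop. 18.76): `S` local and formally smooth over `R`, `J ⊊ S` finitely generated with `S/J`
formally smooth over `R`, `L` a field receiving a local homomorphism from `S/J` such that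
`L ⊗_S Ω[S⁄R] → L ⊗_S Ω[(S/J)⁄R]` is injective. Then `J = 0`.
[cite: GortzWedhorn2023, Thm. 18.74 and Prop. 18.76 (PDF pp. 106–107)] -/
theorem eq_bot_of_formallySmooth_of_injective_map [IsLocalRing S] [Algebra.FormallySmooth R S]
    [Algebra.FormallySmooth R (S ⧸ J)] (hJ : J.FG) (hJtop : J ≠ ⊤) (L : Type u) [Field L]
    [Algebra S L] [Algebra (S ⧸ J) L] [IsScalarTower S (S ⧸ J) L]
    [IsLocalHom (algebraMap (S ⧸ J) L)]
    (hinj : Function.Injective ((KaehlerDifferential.map R R S (S ⧸ J)).baseChange L)) :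
    J = ⊥ :=
  eq_bot_of_formallySmooth_of_injective hJ hJtop L
    ((injective_toKaehler_baseChange_iff R S J L).mpr hinj)

end Bridge

end Literature.AlgebraicGeometry.Smoothening

end
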